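import Literature.AlgebraicTopology.KTheory.BottReduced
import HarnessLib

/-!
# `K̃(S²ⁿ⁺²) ≅ ℤ` — scratch
-/

noncomputable section

open Set Metric TopologicalSpace

namespace Literature.AlgebraicTopology.KTheory

open Literature.RingTheory.KTheory

universe u v

/-! ### Reduced groups along homeomorphisms -/

section Transport

variable {X : Type u} [TopologicalSpace X] {Y : Type v} [TopologicalSpace Y]

/-- **`K̃` along a homeomorphism**: `K̃(Y, h x₀) ≃+ K̃(X, x₀)`. [folklore] -/
def reducedEquivOfHomeomorph (h : X ≃ₜ Y) (x₀ : X) : Reduced Y (h x₀) ≃+ Reduced X x₀ where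
  toFun b := ⟨pullback (h : C(X, Y)) b, by rw [mem_reduced_iff, rankAt_pullback]; exact b.2⟩
  invFun a := ⟨pullback (h.symm : C(Y, X)) a, by
    rw [mem_reduced_iff, rankAt_pullback]
    change rankAt (h.symm (h x₀)) (a : K0 X) = 0
    rw [h.symm_apply_apply]; exact a.2⟩
  left_inv b := Subtype.ext (by
    change pullback (h.symm : C(Y, X)) (pullback (h : C(X, Y)) b) = b
    rw [← AddMonoidHom.comp_apply, ← pullback_comp]
    have : (h : C(X, Y)).comp (h.symm : C(Y, X)) = ContinuousMap.id Y := by ext y; exact h.apply_symm_apply y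
    rw [this, pullback_id]; rfl)
  right_inv a := Subtype.ext (by
    change pullback (h : C(X, Y)) (pullback (h.symm : C(Y, X)) a) = a
    rw [← AddMonoidHom.comp_apply, ← pullback_comp]
    have : (h.symm : C(Y, X)).comp (h : C(X, Y)) = ContinuousMap.id X := by ext x; exact h.symm_apply_apply x
    rw [this, pullback_id]; rfl)
  map_add' b b' := Subtype.ext (map_add _ _ _)

/-- K-theory of spheres (Hatcher VBKT §2). [folklore] -/
@[simp] theorem coe_reducedEquivOfHomeomorph (h : X ≃ₜ Y) (x₀ : X) (b : Reduced Y (h x₀)) :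
    (reducedEquivOfHomeomorph h x₀ b : K0 X) = pullback (h : C(X, Y)) b := rfl

/-- `K̃` at equal base points. [folklore] -/
def reducedCongrPt {y₀ y₁ : Y} (hy : y₀ = y₁) : Reduced Y y₀ ≃+ Reduced Y y₁ := AddEquiv.addSubgroupCongr (by rw [hy])

/-- K-theory of spheres (Hatcher VBKT §2). [folklore] -/
@[simp] theorem coe_reducedCongrPt {y₀ y₁ : Y} (hy : y₀ = y₁) (b : Reduced Y y₀) : (reducedCongrPt hy b : K0 Y) = b := rfl

end Transport

/-! ### `K̃(S²) ≅ ℤ` -/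

section S2

/-- On a one-point space every class is `rank • [1]`. [folklore] -/
theorem reduced_punit_eq_bot : Reduced PUnit.{1} PUnit.unit = ⊥ := by
  rw [eq_bot_iff]
  intro a ha
  rw [AddSubgroup.mem_bot]
  have h : rankAtEquiv PUnit.unit a = rankAtEquiv PUnit.unit 0 := by
    rw [rankAtEquiv_apply, rankAtEquiv_apply, map_zero]; exact ha
  exact (rankAtEquiv PUnit.unit).injective h

/-- The rank of the index: `K⁰(pt × S²) → ℤ`, `pr₁^*α + pr₁^*β·γ ↦ rank β`. [folklore] -/
def indRank : K0 (PUnit.{1} × S2r) →+ ℤ := (rankAt PUnit.unit).comp ind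

/-- K-theory of spheres (Hatcher VBKT §2). [folklore] -/
theorem indRank_bottMap (α β : K0 PUnit.{1}) : indRank (pullback (prX PUnit) α + pullback (prX PUnit) β * bottγ PUnit) = rankAt PUnit.unit β := by
  rw [indRank, AddMonoidHom.comp_apply, map_add, ind_pullback_prX, ind_pullback_prX_mul_bottγ, zero_add]

/-- **`K̃(pt × S²) ≅ ℤ`** via the rank of the index. [cite: HusemollerFibreBundles1994, Ch. 11 Cor. 5.5] -/
theorem indRank_bijective_reduced (s₀ : S2r) :
    Function.Bijective (fun b : Reduced (PUnit.{1} × S2r) (PUnit.unit, s₀) ↦ indRank (b : K0 (PUnit × S2r))) := by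
  constructor
  · intro b b' h
    apply Subtype.ext
    change indRank (b : K0 (PUnit × S2r)) = indRank (b' : K0 (PUnit × S2r)) at h
    rw [← sub_eq_zero, ← map_sub] at h
    rw [← sub_eq_zero]
    have hb : ((b : K0 (PUnit × S2r)) - (b' : K0 (PUnit × S2r))) ∈ Reduced (PUnit.{1} × S2r) (PUnit.unit, s₀) := sub_mem b.2 b'.2
    obtain ⟨α, β, hξ⟩ := bott_surjective ((b : K0 (PUnit × S2r)) - (b' : K0 (PUnit × S2r)))
    rw [hξ, indRank_bottMap] at h
    rw [hξ, mem_reduced_iff, map_add, rankAt_pullback, rankAt_mul, rankAt_pullback, rankAt_bottγ, mul_one] at hb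
    change rankAt PUnit.unit α + rankAt PUnit.unit β = 0 at hb
    rw [h, add_zero] at hb
    have hα : α = 0 := by rw [eq_unitHom_rankAt_of_reduced_eq_bot reduced_punit_eq_bot α, hb, map_zero]
    have hβ : β = 0 := by rw [eq_unitHom_rankAt_of_reduced_eq_bot reduced_punit_eq_bot β, h, map_zero]
    rw [hξ, hα, hβ, map_zero, zero_mul, add_zero]
  · intro k
    refine ⟨⟨pullback (prX PUnit) (KZero.unitHom _ (-k)) + pullback (prX PUnit) (KZero.unitHom _ k) * bottγ PUnit, ?_⟩, ?_⟩
    · rw [mem_reduced_iff, map_add, rankAt_pullback, rankAt_mul, rankAt_pullback, rankAt_bottγ, mul_one, rankAt_unitHom, rankAt_unitHom, neg_add_cancel]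
    · change indRank _ = k
      rw [indRank_bottMap, rankAt_unitHom]

/-- `indRank` on the reduced group, as a homomorphism. [folklore] -/
def indRankReduced (s₀ : S2r) : Reduced (PUnit.{1} × S2r) (PUnit.unit, s₀) →+ ℤ := indRank.comp (AddSubgroup.subtype _)

/-- **`K̃(S²) ≅ ℤ`** (at any base point). [cite: HusemollerFibreBundles1994, Ch. 11 Cor. 5.5] -/
def reducedS2Equiv (s₀ : S2r) : Reduced S2r s₀ ≃+ ℤ :=
  (reducedEquivOfHomeomorph (Homeomorph.punitProd S2r : PUnit.{1} × S2r ≃ₜ S2r) (PUnit.unit, s₀)).trans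
    (AddEquiv.ofBijective (indRankReduced s₀) (indRank_bijective_reduced s₀))

end S2

/-! ### `K̃(Sᵖ⁺²) ≅ K̃(Sᵖ)` and `K̃(S²ⁿ⁺²) ≅ ℤ` -/

section Spheres

/-- **`K̃(Sᵖ⁺²) ≅ K̃(Sᵖ)`** (at the poles): reduced Bott periodicity along `Sᵖ ∧ S² ≅ Sᵖ⁺²`. [cite: HusemollerFibreBundles1994, Ch. 11 Cor. 5.5] -/
def reducedSphereAddTwo (p : ℕ) :
    Reduced (sphere (0 : EuclideanSpace ℝ (Fin (p + 2 + 1))) 1) (pole (p + 2)) ≃+ Reduced (sphere (0 : EuclideanSpace ℝ (Fin (p + 1))) 1) (pole p) :=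
  ((reducedCongrPt (sphereSmashHomeomorph_pt p 2).symm).trans (reducedEquivOfHomeomorph (sphereSmashHomeomorph p 2) _)).trans
    (smashBott (sphere (0 : EuclideanSpace ℝ (Fin (p + 1))) 1) (pole p) (pole 2))

/-- **`K̃(S²ⁿ⁺²) ≅ ℤ`** (Husemöller, *Fibre Bundles*, Ch. 11 Cor. 5.5). [cite: HusemollerFibreBundles1994, Ch. 11 Cor. 5.5] -/
def reducedSphereEvenEquiv : (n : ℕ) → Reduced (sphere (0 : EuclideanSpace ℝ (Fin (2 * n + 2 + 1))) 1) (pole (2 * n + 2)) ≃+ ℤ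
  | 0 => reducedS2Equiv (pole 2)
  | n + 1 => (reducedSphereAddTwo (2 * n + 2)).trans (reducedSphereEvenEquiv n)

end Spheres

end Literature.AlgebraicTopology.KTheory

end
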